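import Summits.QuantumFields.YangMills.Theorems.BalabanUVNodesN07SectCRegimeOfRecordSmall
import Mathlib.Analysis.Calculus.InverseFunctionTheorem.FDeriv
import Mathlib.Analysis.Calculus.FDeriv.Analytic
import HarnessLib

/-!
# N07 at the record — THE LINEARIZING TRANSFORMATION (47) `T47 H₁♭ C^{sl} ε_C` HAS DERIVATIVE `1` AT `0` AND IS ONTO A NEIGHBOURHOOD OF `0`
# (the (47)-specific piece of the KNIT token (cov) ∕ `covers` for the (47)-carrying chart: every small pre-chart field `A″` IS `T47 A′` for a small `A′`)

Cell `pub-ymgap`, seat `pub-ymgap-dag-n07-w3` (g28, WIDTH SEAT 3 on N07 [B11]); helper file keyed `--supports stmt-QuantumFields-27238 --as helper` (K0ᴬ road);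
count-neutral.  INTENT-22 of the seat.  The road's (cov) token «every regular `U` with `Ū^k U = V` is gauge-related to a chart point `S.chart V A`, `A ∈ Kc V`» transfers
from the (47)-free chart to the (47)-carrying one through the LOCAL SURJECTIVITY of `T47` at `0` proved here (inverse function theorem; `DT47(0) = 1` since
`D C^{sl}(0) = 0`).  The gauge-fixing content of (cov) itself ([15] Thm 1 ∕ (21)) is NOT touched.

## What is here (frame-free letters `H₁♭ := H1OfRecordAtBgFlat …`, `C^{sl} := CslOfRecord …`; any `N`)

* ★ `solA_eventuallyEq_T47` — near `0`, `HD(A′) := solA H₁♭ 0 C^{sl} 0 ε_C A′ = −H₁♭(C^{sl}(T47 A′))` as functions (lit ✓`T47_sub_self` on the `a_C`-ball).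
* ★★ `hasFDerivAt_solA_SectC_zero` — `D(HD)(0) = 0` (chain rule on the identity above; `T47 0 = 0`, `DC^{sl}(0) = 0` = `C1Tok` at a guarded background, ✓`c1Tok_of_smallBelow`).
* ★★ `hasStrictFDerivAt_T47_zero` — `T47` has STRICT derivative `1` at `0` (analytic, lit ✓`analyticOnNhd_T47`; Mathlib `AnalyticAt.hasStrictFDerivAt`).
* ★★★ `map_T47_nhds_zero` (`map T47 (𝓝 0) = 𝓝 0`, Mathlib `HasStrictFDerivAt.map_nhds_eq_of_equiv`) and ★★★ `exists_ball_subset_T47_image` — ONE RADIUS `r > 0` such that every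
  `A″` with `‖A″‖ < r` is `T47 A′` for some `A′` with `‖A′‖ < ρ` (any prescribed `0 < ρ`): the (47)-carrying chart reaches every small pre-chart field.

## Honest labels

Calculus bookkeeping (inverse function theorem) on lit's letters under the DISPLAYED Sect. C `Regime` + `Prop4Hyp` (both theorems in the small, frame-free: ✓`exists_sectCRegime_ofRecord`);
nothing of Bałaban's estimates; (cov)'s gauge-fixing content untouched; K0ᴬ ⟨27238⟩ NOT closed; N07 NOT discharged; R4 is the conditional finite-𝕋⁴ rung `BalabanLadder.UV` only;
finite torus at fixed `ε` — nothing continuum ∕ OS ∕ Clay.  **The Yang–Mills mass gap is NOT proved by any of this.**  No `sorry`, no `def`, no `instance ∕ notation`; standard axioms.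
[cite: Balaban1985Variational, (47)–(50) p.285, (55)–(57) p.286, Prop. 3 p.289, Thm 1 p.279]
-/

set_option autoImplicit false

noncomputable section

open scoped Matrix Matrix.Norms.L2Operator InnerProductSpace Topology

namespace Summit.QuantumFields.YangMills.Theorems.N07T47LocalOnto

open Filter Metric
open Literature.MathematicalPhysics.QuantumFieldTheory.Balaban1983to89
open Literature.MathematicalPhysics.QuantumFieldTheory.Balaban1983to89.T4Continuum (T4Family)
open Literature.MathematicalPhysics.QuantumFieldTheory.Balaban1983to89.Node00
open B11Eq103H1Complex (SiteL2K BondL2K)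
open B11Eq174Chart (Regime solA)
open B11Prop6Scheme (Prop4Hyp)
open Summit.QuantumFields.YangMills.Theorems.N07SchemeTokensOfRecord (c1Tok_of_smallBelow)
open B11Eq90V0GroupComposed (T47 T47_apply T47_zero T47_sub_self analyticOnNhd_T47 differentiableOn_solA)

section Record

variable (F : T4Family) (N : ℕ) [NeZero N] (K : ℕ) (k : ℕ) (Ω : ℕ → Set (Site (F.P K) 0)) (U₀ : GaugeField (F.P K) 0 (SU N))
  [Fact (0 < (F.L : ℝ))] [Fact (0 < (F.P K).eta k)] [Fact (0 < c0Rec F K k)] [Fact (∀ c, 0 < wBRec F K k c)]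
  (levB : PBond (F.P K) k → ℕ) (a : ℝ)
  (hposb : ∀ x, x ≠ 0 → 0 < RCLike.re ⟪x, laplaceAOfRecord F N k U₀ (QOfRecord F N k U₀) (QflatOfRecord F N k) a x⟫_ℂ)
  (hQ : Function.Surjective (QOfRecord F N k U₀)) {b C₂ c₄ aC εC : ℝ}
  (RC : Regime (H1OfRecordAtBgFlat F N K k Ω U₀ levB a hposb hQ) (0 : Space115Lit F N K k Ω U₀ →L[ℂ] Space115Lit F N K k Ω U₀)
    (CslOfRecord F N K k Ω U₀ levB) b 0 C₂ c₄ 0 aC εC)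

include RC in
/-- ★ **(49) AS AN IDENTITY OF FUNCTIONS NEAR `0`**: `HD(·) = −H₁♭(C^{sl}(T47 ·))` on the `a_C`-ball (lit ✓`T47_sub_self`). [cite: Balaban1985Variational, (48)–(49) p.285] -/
theorem solA_eventuallyEq_T47 (haC : 0 < aC) :
    (fun A' : Space115Lit F N K k Ω U₀ => solA (H1OfRecordAtBgFlat F N K k Ω U₀ levB a hposb hQ) 0 (CslOfRecord F N K k Ω U₀ levB) 0 εC A') =ᶠ[𝓝 0]
      fun A' => -(H1OfRecordAtBgFlat F N K k Ω U₀ levB a hposb hQ)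
        (CslOfRecord F N K k Ω U₀ levB (T47 (H1OfRecordAtBgFlat F N K k Ω U₀ levB a hposb hQ) (CslOfRecord F N K k Ω U₀ levB) εC A')) := by
  filter_upwards [Metric.ball_mem_nhds (0 : Space115Lit F N K k Ω U₀) haC] with A' hA'
  have h := T47_sub_self RC (mem_ball_zero_iff.1 hA')
  rw [T47_apply, add_sub_cancel_left] at h
  exact h

include RC in
/-- ★★ **`D(HD)(0) = 0`**: the Sect. C correction `A′ ↦ HD(A′)` has zero derivative at `0` — differentiate `HD = −H₁♭ ∘ C^{sl} ∘ T47` at `0` (`T47 0 = 0`, `DC^{sl}(0) = 0`).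
[cite: Balaban1985Variational, (49) p.285, (55)–(56) p.286, Prop. 3 p.289] -/
theorem hasFDerivAt_solA_SectC_zero (hU₀ : SmallBelow (avOfRecord F N K) k U₀) (hC : Prop4Hyp (CslOfRecord F N K k Ω U₀ levB) C₂ c₄) (haC : 0 < aC) :
    HasFDerivAt (solA (H1OfRecordAtBgFlat F N K k Ω U₀ levB a hposb hQ) 0 (CslOfRecord F N K k Ω U₀ levB) 0 εC)
      (0 : Space115Lit F N K k Ω U₀ →L[ℂ] Space115Lit F N K k Ω U₀) 0 := by
  -- `T47` is differentiable at `0` with some derivative `L`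
  have hT : HasFDerivAt (T47 (H1OfRecordAtBgFlat F N K k Ω U₀ levB a hposb hQ) (CslOfRecord F N K k Ω U₀ levB) εC)
      (fderiv ℂ (T47 (H1OfRecordAtBgFlat F N K k Ω U₀ levB a hposb hQ) (CslOfRecord F N K k Ω U₀ levB) εC) 0) 0 :=
    ((analyticOnNhd_T47 RC hC 0 (mem_ball_self haC)).differentiableAt).hasFDerivAt
  -- `C^{sl}` has derivative `0` at `T47 0 = 0`
  have hCd : HasFDerivAt (CslOfRecord F N K k Ω U₀ levB) (0 : Space115Lit F N K k Ω U₀ →L[ℂ] _)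
      (T47 (H1OfRecordAtBgFlat F N K k Ω U₀ levB a hposb hQ) (CslOfRecord F N K k Ω U₀ levB) εC 0) := by
    rw [T47_zero RC haC]
    exact c1Tok_of_smallBelow F N K k Ω U₀ levB hU₀
  have hcomp := ((H1OfRecordAtBgFlat F N K k Ω U₀ levB a hposb hQ).hasFDerivAt.comp 0 (hCd.comp 0 hT)).neg
  simp only [ContinuousLinearMap.zero_comp, ContinuousLinearMap.comp_zero, neg_zero] at hcomp
  exact hcomp.congr_of_eventuallyEq (solA_eventuallyEq_T47 F N K k Ω U₀ levB a hposb hQ RC haC)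

include RC in
/-- ★★ **`T47` HAS STRICT DERIVATIVE `1` AT `0`** (analytic on the ball, lit ✓`analyticOnNhd_T47`; `DT47(0) = 1 + D(HD)(0) = 1`). [cite: Balaban1985Variational, (47) p.285, Prop. 3 p.289] -/
theorem hasStrictFDerivAt_T47_zero (hU₀ : SmallBelow (avOfRecord F N K) k U₀) (hC : Prop4Hyp (CslOfRecord F N K k Ω U₀ levB) C₂ c₄) (haC : 0 < aC) :
    HasStrictFDerivAt (T47 (H1OfRecordAtBgFlat F N K k Ω U₀ levB a hposb hQ) (CslOfRecord F N K k Ω U₀ levB) εC)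
      ((ContinuousLinearEquiv.refl ℂ (Space115Lit F N K k Ω U₀) : Space115Lit F N K k Ω U₀ →L[ℂ] Space115Lit F N K k Ω U₀)) 0 := by
  have han : AnalyticAt ℂ (T47 (H1OfRecordAtBgFlat F N K k Ω U₀ levB a hposb hQ) (CslOfRecord F N K k Ω U₀ levB) εC) 0 :=
    analyticOnNhd_T47 RC hC 0 (mem_ball_self haC)
  have hstrict := han.hasStrictFDerivAt
  -- identify the derivative: `T47 = id + HD`, `D(HD)(0) = 0`
  have hsum : HasFDerivAt (T47 (H1OfRecordAtBgFlat F N K k Ω U₀ levB a hposb hQ) (CslOfRecord F N K k Ω U₀ levB) εC)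
      (ContinuousLinearMap.id ℂ (Space115Lit F N K k Ω U₀) + 0) 0 := by
    have h := (hasFDerivAt_id (𝕜 := ℂ) (0 : Space115Lit F N K k Ω U₀)).add (hasFDerivAt_solA_SectC_zero F N K k Ω U₀ levB a hposb hQ RC hU₀ hC haC)
    exact h
  rw [add_zero] at hsum
  have hfd : fderiv ℂ (T47 (H1OfRecordAtBgFlat F N K k Ω U₀ levB a hposb hQ) (CslOfRecord F N K k Ω U₀ levB) εC) 0 =
      ContinuousLinearMap.id ℂ (Space115Lit F N K k Ω U₀) := hsum.fderiv
  rw [hfd] at hstrict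
  rw [ContinuousLinearEquiv.coe_refl]
  exact hstrict

include RC in
/-- ★★★ **`T47` MAPS NEIGHBOURHOODS OF `0` ONTO NEIGHBOURHOODS OF `0`**: `map T47 (𝓝 0) = 𝓝 0` (inverse function theorem). [cite: Balaban1985Variational, (47) p.285, Prop. 3 p.289] -/
theorem map_T47_nhds_zero (hU₀ : SmallBelow (avOfRecord F N K) k U₀) (hC : Prop4Hyp (CslOfRecord F N K k Ω U₀ levB) C₂ c₄) (haC : 0 < aC) :
    Filter.map (T47 (H1OfRecordAtBgFlat F N K k Ω U₀ levB a hposb hQ) (CslOfRecord F N K k Ω U₀ levB) εC) (𝓝 0) = 𝓝 0 := by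
  have h := (hasStrictFDerivAt_T47_zero F N K k Ω U₀ levB a hposb hQ RC hU₀ hC haC).map_nhds_eq_of_equiv
  rwa [T47_zero RC haC] at h

include RC in
/-- ★★★ **THE (47)-CARRYING CHART REACHES EVERY SMALL PRE-CHART FIELD**: for every `0 < ρ` there is `r > 0` such that every `A″` with `‖A″‖ < r` is `T47 A′` for some `A′` with `‖A′‖ < ρ`
(the (47)-specific piece of the (cov) token). [cite: Balaban1985Variational, (47) p.285, Prop. 3 p.289, Thm 1 p.279] -/
theorem exists_ball_subset_T47_image (hU₀ : SmallBelow (avOfRecord F N K) k U₀) (hC : Prop4Hyp (CslOfRecord F N K k Ω U₀ levB) C₂ c₄) (haC : 0 < aC) {ρ : ℝ} (hρ : 0 < ρ) :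
    ∃ r : ℝ, 0 < r ∧ ∀ A'' : Space115Lit F N K k Ω U₀, ‖A''‖ < r →
      ∃ A' : Space115Lit F N K k Ω U₀, ‖A'‖ < ρ ∧
        T47 (H1OfRecordAtBgFlat F N K k Ω U₀ levB a hposb hQ) (CslOfRecord F N K k Ω U₀ levB) εC A' = A'' := by
  have hmem : T47 (H1OfRecordAtBgFlat F N K k Ω U₀ levB a hposb hQ) (CslOfRecord F N K k Ω U₀ levB) εC '' Metric.ball 0 ρ ∈
      𝓝 (0 : Space115Lit F N K k Ω U₀) := by
    rw [← map_T47_nhds_zero F N K k Ω U₀ levB a hposb hQ RC hU₀ hC haC]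
    exact Filter.image_mem_map (Metric.ball_mem_nhds 0 hρ)
  obtain ⟨r, hr, hball⟩ := Metric.mem_nhds_iff.1 hmem
  refine ⟨r, hr, fun A'' hA'' => ?_⟩
  obtain ⟨A', hA', hEq⟩ := hball (mem_ball_zero_iff.2 hA'')
  exact ⟨A', mem_ball_zero_iff.1 hA', hEq⟩

end Record

end Summit.QuantumFields.YangMills.Theorems.N07T47LocalOnto

end
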